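import Mathlib

/-!
# The two-tale point P15: residue bookkeeping (`{n/p}` versus `n mod p`, floor digits from bounds)

HONEST FRAMING: systematic search; no irrationality claim unless certified.

Cell pub-zeta5, T3 service.  Three elementary lemmas shared by the first- and second-tale P15 files
(`TwoTaleP15FirstTale`, `TwoTaleP15SecondTale`): the translation of a class condition `u ≤ {n/p} < v` (as in
`RhinViola.classPrimes`) into integer inequalities on `n mod p`, and the reading of an integer floor quotient from a
decomposition `X = p·A + B` with the digit of `B` given by bounds.
-/

namespace Summit.KontsevichZagierPeriods.Zeta5Search.TwoTaleP15

/-! ### From `{n/p} ∈ [u,v)` to residue bounds -/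

/-- `{n/p} ∈ [U₁/U₂, V₁/V₂)` as integer inequalities on `n mod p`: `U₁ p ≤ U₂ (n mod p)` and `V₂ (n mod p) < V₁ p`
(`{n/p} = (n mod p)/p`). -/
theorem mod_bounds_of_fract {n p U₁ U₂ V₁ V₂ : ℕ} (hp : 0 < p) (hU : 0 < U₂) (hV : 0 < V₂)
    (h1 : ((U₁ : ℝ) / U₂) ≤ Int.fract ((n : ℝ) / p)) (h2 : Int.fract ((n : ℝ) / p) < (V₁ : ℝ) / V₂) :
    U₁ * p ≤ U₂ * (n % p) ∧ V₂ * (n % p) < V₁ * p := by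
  rw [Int.fract_div_natCast_eq_div_natCast_mod] at h1 h2
  have hp' : (0 : ℝ) < p := by exact_mod_cast hp
  have hU' : (0 : ℝ) < U₂ := by exact_mod_cast hU
  have hV' : (0 : ℝ) < V₂ := by exact_mod_cast hV
  rw [div_le_div_iff₀ hU' hp'] at h1
  rw [div_lt_div_iff₀ hp' hV'] at h2
  constructor
  · have : ((U₁ * p : ℕ) : ℝ) ≤ ((U₂ * (n % p) : ℕ) : ℝ) := by push_cast; linarith
    exact_mod_cast this
  · have : ((V₂ * (n % p) : ℕ) : ℝ) < ((V₁ * p : ℕ) : ℝ) := by push_cast; linarith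
    exact_mod_cast this

/-- One floor digit from its bounds: `B/p = j` when `j p ≤ B < (j+1) p` (`p > 0`). -/
theorem ediv_eq_of_bounds {B j p : ℤ} (hp : 0 < p) (h : j * p ≤ B ∧ B < (j + 1) * p) : B / p = j := by
  have h1 : j ≤ B / p := (Int.le_ediv_iff_mul_le hp).2 h.1
  have h2 : B / p < j + 1 := (Int.ediv_lt_iff_lt_mul hp).2 h.2
  omega

/-- A natural-number quotient read off from a decomposition `X = p·A + B`, `⌊B/p⌋ = j`:
`⌊X/p⌋ = A + j`. -/
theorem natDiv_cast_eq {X : ℤ} {p : ℕ} (hp : 0 < p) (A B j : ℤ) (hX0 : 0 ≤ X) (hX : X = p * A + B)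
    (hB : j * p ≤ B ∧ B < (j + 1) * p) : ((X.toNat / p : ℕ) : ℤ) = A + j := by
  have hp' : (0 : ℤ) < p := by exact_mod_cast hp
  rw [Int.natCast_ediv, Int.toNat_of_nonneg hX0, hX, Int.mul_add_ediv_left _ _ hp'.ne', ediv_eq_of_bounds hp' hB]


end Summit.KontsevichZagierPeriods.Zeta5Search.TwoTaleP15
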